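import Summits.QuantumFields.YangMills.Theorems.BalabanUVNodesN19RateEdgeByName
import Summits.QuantumFields.YangMills.Theorems.BalabanUVNodesN19LipBracketTube

/-!
# BalabanUVNodes ∕ N19 — THE TWO N19 EDGE READINGS WITH THE BRACKET (T) CONSUMED IN THE TUBE CURRENCY: the pin-free compact reading
# (n27-a's `coreEdge_of_ledgerAtSyncReading` :81) and the 113-component by-name link reading (`N19RateEdgeByName.rateEdge_of_linkReading_byName`,
# p429766) re-cut with the raw components `LipBackground ∧ PolyLipGrowth ∧ 0 ≤ Pg` REPLACED by the inputs of `N19LipBracketTube` §3–§4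
# (cell `pub-ymgap`, HUMAN RULING D-0062 Track A, node N19 = NE7, R134 seat dag-n19-c g2, strategy s1′ — the «v8»; count-neutral)

WHY.  After `N19LipBracketTube` (p460518) the argument bracket's Lipschitz factor (T) of `T4OutputRate.u3_threeBrackets` :227 is a THEOREM over the
abstract carriers from eleven printed-shape binders — `DecayBound` ((I.1.18)), the pair-disc shape at the printed tube radius `κ₁·α(C₁, q₁, g_j)` ((2.27)(ii)(iv)
read through the (I.1.13) ∕ [III] (2.39) tube — SHAPE, NODE O), signs, the window's smallness, run A's tables with their upper running ((2.6) ∕ (0.31)) —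
but both N19 edge readings in the tree still carry (T) RAW: n27-a's PIN-FREE compact reading `BalabanUVNodesN27AtRecordReadings.coreEdge_of_ledgerAtSyncReading`
(the face `spine_of_readings` and n19-d's `N19TargetAtRecord11Currency.matching_at_record₁₁_of_ledgerAtSyncReading` consume) and the by-name link reading
`N19RateEdgeByName.rateEdge_of_linkReading_byName` (clause :203).  THIS FILE re-cuts both with (T) CONSUMED: the three components and their ∃-letters
`CU Pg q` are replaced by the tube letters `E₀T κ₁ C₁ β′ : ℝ`, `q₁ : ℕ` and the tube inputs; the proofs are ONE `obtain` on `lipBracket_of_pairDisc` ∕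
`lipBracket_at_rateCarriers_of_pairDisc` followed by the original closing terms VERBATIM (`N19LedgerLinkSync.core_summable_of_ledgerAtSync` ∕ knit v6
`core_summable_of_ledgerAtSync_multByName` over `ledgerAtSync_withLoc`).  The word for this re-cut was asked of dag-lead three times (pub-ymgap INBOX
l.12272, l.12309, l.12667) and announced as INTENT-4 (l.13170); no word either way — filed as the row's last kernel-reachable piece.

WHAT THIS FILE PROVES.
* §1 **`coreEdge_of_ledgerAtSyncReading_pairDisc`** — n27-a's compact reading over ABSTRACT carriers `C` (`LedgerAtSync` + N16 `NE3Shape`∕`GaugeDominated`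
  + N18 `NE5` + N22 `NE9 ∧ FadingMemory` + node U2 `InjectedRate` + the box + window memberships) with (T) replaced by: `DecayBound EA W E₀T κ`; the
  pair-disc shape at radius `κ₁·alphaJ C₁ q₁ (s (scale X))`; `0 ≤ E₀T`, `0 < κ₁`, `0 < C₁`; `∀ s ∈ W, ∀ j, 0 < s_j ∧ s_j² ≤ e⁻¹`; the upper running
  `1∕(g K j)² ≤ 1∕gIR² + β′(K − j)` with `0 < gIR`, `0 ≤ β′` ⇒ the SAME ∃δ-edge `∃ δ, NE7.Core S.l₀ S.vol S.T S.Bad (A − shA) (B − shB) δ ∧ Summable δ`.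
* §2 **`rateEdge_of_linkReading_byName_pairDisc`** — the by-name link reading at the two carrier records `(SRec, RRec)` with clause (T) :203 so replaced
  (here `0 < gIR` is DERIVED from the box and the infrared pin `g K K = gIR`), N14 · N16 · N17 · N18 · N22 consumed from `RatesAt D R` BY NAME exactly
  as in p429766 (staged destructuring, PROOF NOTE there), same conclusion.

WHAT REMAINS DISPLAYED (census of the edge after this file): everything `N19RateEdgeByName`'s header lists EXCEPT the bracket (T), whose place is taken by
the pair-disc SHAPE on the carriers of record (NODE O: that the tube path `s ↦ (exp(iξ(s∕δ)Z)·U, J-path)` stays in `Ũᶜ_j(X)` for `|s| < κ₁α_{1,j}` —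
clauses (iii) by definition, (2.34)∕(2.36) printed kind, (2.38) = N04∕N05, (iv)∕(2.35)(2.37) = N07 for complex data, the J-coordinate = N16's rates;
see `N19LipBracketTube`'s header for the two LOCATED instancer items: C¹ currency of NE3's closeness, layer indexing of the radius), the (1.18) real bound
(printed form) and the (2.6)∕(0.31) upper running (printed, β-side conditional like `EventualLowerH`).

HONEST FRAMING.  Count-neutral kernel bookkeeping; NE7 NOT PRINTED ∕ NOT proved; `SRec`, `RRec`, `Inputs` are PARAMETERS (no carrier of record exists in
the tree); nothing of Bałaban's is asserted or instantiated; N19 NOT discharged; one finite four-torus at fixed ε, rung (B)+1 — NOT infinite volume, NOT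
OS on ℝ⁴, NOT a mass gap, NOT Clay.  THEOREMS ONLY; 0 `def`; 0 `sorry`; standard axioms.  Supersedes nothing (p429766 and n27-a's :81 stay the raw-(T)
forms; neither file is edited).  Filed `--supports` the K3 item `SpineGivenEndpointR11`.  No decl below carries a cite tag; locators as in
`N19LipBracketTube` ([Balaban1987RG1] (1.13) p. 262, (1.18) p. 263; [Balaban1988Convergent] (2.6) p. 255, (2.27)–(2.28) p. 259, (2.39) p. 261).
-/

set_option autoImplicit false

noncomputable section

open Finset MeasureTheory
open scoped BigOperators Matrix Matrix.Norms.L2Operator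

namespace Summit.QuantumFields.YangMills.BalabanUVNodes.N19RateEdgeTube

open Literature.MathematicalPhysics.QuantumFieldTheory.Balaban1983to89
open T4OutputRate T4RecentScale T4GoodClassBudget T4CauchySum T4TowerRateComposition T4TowerRateDischarge
open T4EtaRateMin (Readings NE3Shape)
open T4RateLiaison (GaugeDominated)
open T4CouplingMatching (EventualLowerH)
open FlowStep (RGEqH)
open TreeLengthTorus (TFaceConnected torusTreeLen)
open B12TreeDecay (kappa₀)
open Summit.QuantumFields.BalabanUV.T4Continuum
open AveragingDeficitDualResidual (dualC1 dualC2)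
open AveragingDeficitDerivWallProof (wallConst)
open AveragingDeficitPeriodicCounting (IsPeriodicDir)
open MinimalActionSandwich (IsMinimiser minAct)
open MinimalActionRate (sfClass)
open MinimalActionRefine (RegularSup gradConst)
open NE3EnergyShapes (IsUnitarySite IsPeriodicSite)
open NE3.LeafIndexSockets (LeafH3sup)
open Summit.QuantumFields.BalabanUV.T4Continuum.Spine
open Summit.QuantumFields.BalabanUV.T4Continuum.NE1p.DressedRoot (DressedTower DressedStabilityStrict)
open Summit.QuantumFields.YangMills.BalabanUVNodes.N19LedgerLinkSync (LedgerDataSync LedgerAtSync core_summable_of_ledgerAtSync)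
open Summit.QuantumFields.YangMills.BalabanUVNodes.N19MultiplicityByName (core_summable_of_ledgerAtSync_multByName)
open Summit.QuantumFields.YangMills.BalabanUVNodes.N19RateEdge (ne5_of_n18At dressedStabilityStrict_of_n14At)
open Summit.QuantumFields.YangMills.BalabanUVNodes.N19InEdgesAtRecord (ledgerAtSync_withLoc ne3Liaison_of_covRoot injectedRate_of_n17At_readOutAt)
open Summit.QuantumFields.YangMills.BalabanUVNodes.N19LipBracketTube (lipBracket_of_pairDisc lipBracket_at_rateCarriers_of_pairDisc)
open YMDAG.UVSplit (SpineCarriers SpineRecordPred InputsPred U3Carriers RateCarriers RateRecordPred N14At N18At N22At RatesAt ReadOutAt)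

/-! ## §1 The pin-free compact reading (n27-a's form) with (T) in the tube currency -/

section Compact

variable {N : ℕ} [NeZero N]

/-- **THE ∃δ-EDGE OF N19 FROM THE SYNCHRONISED-LEDGER READING, (T) IN THE TUBE CURRENCY** [bookkeeping].  The hypothesis is n27-a's
`BalabanUVNodesN27AtRecordReadings.coreEdge_of_ledgerAtSyncReading` reading over abstract carriers `C` — `LedgerAtSync L …`, N16 `NE3Shape R C₃ θ₃` +
`GaugeDominated R uA uB`, N18 `NE5`, N22 `NE9 ∧ FadingMemory`, node U2's `InjectedRate Cd 0 θc disc`, the box `0 < g K i ≤ γ`, the window memberships —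
EXCEPT that the raw bracket `LipBackground EA W κ CU ∧ PolyLipGrowth CU g Pg q ∧ 0 ≤ Pg` is replaced by the tube inputs of
`N19LipBracketTube.lipBracket_of_pairDisc`: `DecayBound EA W E₀T κ` ((1.18)), the pair-disc shape at the printed tube radius `κ₁·α(C₁, q₁, s_j)`
((2.27)(ii)(iv) through (1.13)∕(2.39); SHAPE, NODE O), `0 ≤ E₀T`, `0 < κ₁`, `0 < C₁`, the window's smallness, the upper running of the tables with
`0 < gIR`, `0 ≤ β′`.  CONCLUSION: the same ∃δ-edge, by `lipBracket_of_pairDisc` then `N19LedgerLinkSync.core_summable_of_ledgerAtSync` BY NAME.  NOT NE7;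
N19 NOT discharged. [folklore] -/
theorem coreEdge_of_ledgerAtSyncReading_pairDisc (SRec : SpineRecordPred N) (Inputs : InputsPred N)
    (hread : ∀ (F : T4Continuum.T4Family) (D : YMDAG.UVSplit.Datum F N) (g₀ : ℕ → ℝ) (os : List (T4Continuum.ULoop F))
      (S : SpineCarriers), SRec F D g₀ os S → Inputs F D g₀ os → letI := S.dec
      ∃ (C : Carriers) (_ : DecidableEq C.Dom) (F' : Type) (ι' X' : Type) (_ : MeasurableSpace ι')
        (L : LedgerDataSync C F' ι' S.ι) (R : Readings ι' X') (W : Set (ℕ → ℝ)) (EA : Functional C C.BgA)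
        (EB : Functional C C.BgB) (κ θ₅ C₅ C₉ ω θc Cd γ C₃ θ₃ : ℝ) (Λm : ℕ → ℕ → ℝ)
        (g : ℕ → ℕ → ℝ) (uA : ℕ → ι' → C.BgA) (uB : ℕ → ι' → C.BgB)
        -- TUBE letters of the bracket (T)
        (E₀T κ₁ C₁ β' gIR : ℝ) (q₁ : ℕ),
        LedgerAtSync L S.l₀ S.vol S.T S.Bad (fun K t τ => S.A K t τ - S.shA K t τ) (fun K t τ => S.B K t τ - S.shB K t τ)
          R EA EB κ g uA uB ω θc θ₅ θ₃ ∧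
        NE3Shape R C₃ θ₃ ∧ 0 ≤ C₃ ∧ GaugeDominated R uA uB ∧
        NE5 EA EB W κ θ₅ C₅ ∧ 0 ≤ θ₅ ∧ 0 ≤ C₅ ∧
        (NE9 EA W κ Λm ∧ T4OutputRate.FadingMemory C₉ ω Λm) ∧ 0 ≤ ω ∧
        InjectedRate Cd 0 θc (fun K j => T4CouplingMatching.disc (g K) (g (K + 1)) j) ∧ 0 ≤ Cd ∧ 0 ≤ θc ∧
        (∀ K i, i ≤ K → 0 < g K i ∧ g K i ≤ γ) ∧
        -- the bracket (T) IN THE TUBE CURRENCY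
        DecayBound EA W E₀T κ ∧
        (∀ s ∈ W, ∀ (X : C.Dom) (U U' : C.BgA), C.gauge U U' < κ₁ * B14.alphaJ C₁ q₁ (s (C.scale X)) →
          ∃ f : ℂ → ℂ, DifferentiableOn ℂ f (Metric.ball (0 : ℂ) (κ₁ * B14.alphaJ C₁ q₁ (s (C.scale X)))) ∧
            f 0 = (EA s U X : ℂ) ∧ f (C.gauge U U' : ℂ) = (EA s U' X : ℂ) ∧
            ∀ z ∈ Metric.ball (0 : ℂ) (κ₁ * B14.alphaJ C₁ q₁ (s (C.scale X))), ‖f z‖ ≤ E₀T * Real.exp (-(κ * C.d X))) ∧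
        0 ≤ E₀T ∧ 0 < κ₁ ∧ 0 < C₁ ∧ (∀ s ∈ W, ∀ j, 0 < s j ∧ s j ^ 2 ≤ Real.exp (-1)) ∧
        (∀ K j, j ≤ K → 1 / g K j ^ 2 ≤ 1 / gIR ^ 2 + β' * ((K : ℝ) - j)) ∧ 0 < gIR ∧ 0 ≤ β' ∧
        -- window memberships
        (∀ K, g K ∈ W) ∧ (∀ K, (fun i => g (K + 1) (i + 1)) ∈ W))
    (F : T4Continuum.T4Family) (D : YMDAG.UVSplit.Datum F N) (g₀ : ℕ → ℝ) (os : List (T4Continuum.ULoop F)) (S : SpineCarriers)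
    (hS : SRec F D g₀ os S) (hI : Inputs F D g₀ os) : letI := S.dec
      ∃ δ : ℕ → ℝ, NE7.Core S.l₀ S.vol S.T S.Bad (fun K t τ => S.A K t τ - S.shA K t τ) (fun K t τ => S.B K t τ - S.shB K t τ) δ ∧
        Summable δ := by
  letI := S.dec
  obtain ⟨C, _, F', ι', X', _, L, R, W, EA, EB, κ, θ₅, C₅, C₉, ω, θc, Cd, γ, C₃, θ₃, Λm, g, uA, uB, E₀T, κ₁, C₁, β', gIR, q₁, hL, h16,
    hC₃, hgd, h18, hθ₅, hC₅, h22, hω, hinj, hCd, hθc, hbox, hrest⟩ := hread F D g₀ os S hS hI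
  obtain ⟨hdecT, hdiscT, hE₀T, hκ₁, hC₁, hWsm, hup, hgIR, hβ', hgA, hgB⟩ := hrest
  obtain ⟨CU, Pg, hU, hG, hPg⟩ := lipBracket_of_pairDisc hdecT hdiscT hE₀T hκ₁ hC₁ hWsm hgA hup hgIR hβ'
  exact core_summable_of_ledgerAtSync hL h16 hC₃ hgd h18 hθ₅ hC₅ h22 hω hinj hCd hθc hbox hU hG hPg hgA hgB

end Compact

/-! ## §2 The by-name link reading at the two carrier records (the «v8» of `rateEdge_of_linkReading_byName`) -/

section Edge

variable {N : ℕ} [NeZero N]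

/-- **THE N19′ RATE EDGE AT THE TWO CARRIER RECORDS, IN-EDGES BY NAME, (T) IN THE TUBE CURRENCY** [bookkeeping].  IDENTICAL to
`N19RateEdgeByName.rateEdge_of_linkReading_byName` (p429766; read its docstring for the clause-by-clause census) EXCEPT in clause (v′): the three raw
components `LipBackground R.u3.EA R.u3.W R.u3.κ CU ∧ PolyLipGrowth CU g Pg q ∧ 0 ≤ Pg` (:203) and the ∃-letters `CU Pg q` are GONE; in their place
the tube letters `E₀T κ₁T C₁T β′T : ℝ`, `q₁ : ℕ` and the inputs of `N19LipBracketTube.lipBracket_at_rateCarriers_of_pairDisc R` — `DecayBound R.u3.EA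
R.u3.W E₀T R.u3.κ` ((1.18)), the pair-disc shape of run A's terms at the printed tube radius `κ₁T·α(C₁T, q₁, s_j)` ((2.27)(ii)(iv) through
(1.13)∕(2.39); SHAPE, NODE O), `0 ≤ E₀T`, `0 < κ₁T`, `0 < C₁T`, the window's smallness `0 < s_j`, `s_j² ≤ e⁻¹` on `R.u3.W`, and the UPPER running
`1∕(g K j)² ≤ 1∕gIR² + β′T(K − j)` ((2.6) ∕ (0.31) upper half; DISPLAYED, β-side conditional) with `0 ≤ β′T`; `0 < gIR` is derived from the box and
the pin.  SAME conclusion `SRec … S → RRec … R → RatesAt D R → ∃ δ, NE7.Core … δ ∧ Summable δ`; N14 · N16 · N17 · N18 · N22 from `RatesAt D R` BY NAME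
as there.  NOT NE7; N19 NOT discharged. [folklore] -/
theorem rateEdge_of_linkReading_byName_pairDisc (SRec : SpineRecordPred N) (RRec : RateRecordPred N)
    (hlink : ∀ (F : T4Continuum.T4Family) (D : YMDAG.UVSplit.Datum F N) (g₀ : ℕ → ℝ) (os : List (T4Continuum.ULoop F))
      (S : SpineCarriers) (R : RateCarriers N), SRec F D g₀ os S → RRec F D g₀ os R → letI := S.dec
      ∃ (_ : DecidableEq R.u3.C.Dom) (F' : Type) (ι' X' : Type) (_ : MeasurableSpace ι')
        (L : LedgerDataSync R.u3.C F' ι' S.ι) (Rd : Readings ι' X') (bsel : (ℕ → ℝ) → ℝ) (EB : Functional R.u3.C R.u3.C.BgB)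
        (θc θ₃ : ℝ) (g : ℕ → ℕ → ℝ)
        (uA : ℕ → ι' → R.u3.C.BgA) (uB : ℕ → ι' → R.u3.C.BgB)
        (Pf : ℕ → Params) (d₀ L₀ Koff : ℕ) (cells : (K j : ℕ) → R.u3.C.Dom → Finset (Site (Pf K) j))
        (H033 : Flow → ℕ → Prop) (I : Type) (fam : I → B14.Sect2Data) (Lb β : ℝ) (κ₁ : ℕ) (Gv Cl : ℝ) (K₁ : ℕ)
        (Λ₀ N₀ : ℝ) (dressed : R.u3.C.Dom → Prop) (_ : DecidablePred dressed)
        -- N16-side letters: regime, selection, reading map, NE7 route-#1 side letters, offset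
        (c' t ε₁ θ γ₃ l₁ : ℝ)
        (sel : ℕ → (B7Prop1Explicit.Site 4 → Fin 4 → (Matrix (Fin N) (Fin N) ℂ)ˣ) → (B7Prop1Explicit.Site 4 → Fin 4 → (Matrix (Fin N) (Fin N) ℂ)ˣ))
        (rd : ι' → (B7Prop1Explicit.Site 4 → Fin 4 → (Matrix (Fin N) (Fin N) ℂ)ˣ)) (k₀ : ℕ)
        -- N17-side letters: infrared pin, β-window
        (gIR bβ : ℝ) (k₀β : ℕ)
        -- TUBE letters of the bracket (T): the (1.18) constant, the layer factor and (2.28)'s `C₁, q₁`, the flow's `β′`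
        (E₀T κ₁T C₁T β'T : ℝ) (q₁ : ℕ),
        -- the run-B functional is the first-coupling family read through the selector
        EB = (fun s => R.u3.EB (bsel s) s) ∧
        -- (i) the ledger predicate for whatever size data and census constants meet their clauses
        (∀ (Sz : ℕ → ℝ → S.ι → ℕ → ℝ) (E₀ : ℝ) (m : ℕ) (a : ℝ) (Cw Λg : ℝ),
          (∀ K t, |t| ≤ S.l₀ → ∀ τ ∈ S.T K \ S.Bad K t, ∀ v ∈ Rd.dom, ∀ j ≤ K,
            |∑ X ∈ L.fac K t τ with R.u3.C.scale X = j,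
                (Real.log (Real.exp (EB (fun i => g (K + 1) (i + 1)) (uB K v) X
                    - EB (fun i => g (K + 1) (i + 1)) L.oneB X))
                  - Real.log (Real.exp (R.u3.EA (g K) (uA K v) X - R.u3.EA (g K) L.oneA X)))| ≤ Sz K t τ j) →
          0 ≤ E₀ → 0 < a → a < 1 →
          (∀ K t, |t| ≤ S.l₀ → ∀ τ ∈ S.T K \ S.Bad K t, ∀ j ≤ K,
            Sz K t τ j ≤ S.vol * (E₀ * ((K : ℝ) + 1) ^ m * a ^ (K - j))) →
          (∀ K, Multiplicity (L.All K) R.u3.C.scale (fun X => Real.exp (-(R.u3.κ * R.u3.C.d X))) Cw S.vol Λg K) →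
          (∀ K t, |t| ≤ S.l₀ → ∀ τ ∈ S.T K \ S.Bad K t,
            WindowMultiplicity (L.facO K t τ) L.scO L.wO Cw S.vol Λg (jlogOf L.Cl K) K) →
          1 ≤ Λg → L.θ' ≤ Λg →
          LedgerAtSync { L with S := Sz, E₀ := E₀, m := m, a := a, Cw := Cw, Λg := Λg } S.l₀ S.vol S.T S.Bad
            (fun K t τ => S.A K t τ - S.shA K t τ) (fun K t τ => S.B K t τ - S.shB K t τ) Rd R.u3.EA EB R.u3.κ g uA uB
            R.u3.ω θc R.u3.θ θ₃) ∧
        0 ≤ S.vol ∧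
        (∀ K t, |t| ≤ S.l₀ → ∀ τ ∈ S.T K \ S.Bad K t,
          WindowMultiplicity (L.facO K t τ) L.scO L.wO L.Cw S.vol L.Λg (jlogOf L.Cl K) K) ∧
        0 ≤ L.Cw ∧ 1 ≤ L.Λg ∧ L.θ' ≤ L.Λg ∧
        -- (ii-m) the reference ledger's lattice identification
        (∀ K, (Pf K).d = d₀) ∧ (∀ K, (Pf K).L = L₀) ∧ (∀ K, (Pf K).K = Koff + K) ∧
        (∀ K, (Fintype.card (Site (Pf K) (Pf K).K) : ℝ) = S.vol) ∧
        kappa₀ (4 * 2 ^ d₀) (2 * d₀) ≤ R.u3.κ ∧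
        (∀ K, ∀ X ∈ L.All K,
          (cells K (R.u3.C.scale X + Koff) X).Nonempty ∧ TFaceConnected (cells K (R.u3.C.scale X + Koff) X)) ∧
        (∀ K j, Set.InjOn (cells K j) ↑((L.All K).filter fun X => R.u3.C.scale X + Koff = j)) ∧
        (∀ K, ∀ X ∈ L.All K, torusTreeLen (cells K (R.u3.C.scale X + Koff) X) ≤ R.u3.C.d X) ∧
        -- (iii) [III] Theorem 2 (2.43) AS PRINTED with window letters
        B14.Thm2Printed H033 fam Lb β κ₁ ∧ β < 1 ∧ 0 < β ∧ 1 < Lb ∧ 1 ≤ Gv ∧ 0 ≤ Cl ∧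
        -- (iv) the positional-count half of N14's pinned pair at a rate `≤ R.ne1.Λ`
        (∀ p K, (R.ne1.𝒯.B p K).PositionalCount fun j k => N₀ * Λ₀ ^ (k - j)) ∧ 0 ≤ N₀ ∧ 0 ≤ Λ₀ ∧ Λ₀ ≤ R.ne1.Λ ∧
        -- (ii-v-A) run A's vacuum slices ↔ printed E-terms
        (∀ K t, |t| ≤ S.l₀ → ∀ τ ∈ S.T K \ S.Bad K t, ∀ v ∈ Rd.dom, ∀ j ≤ K, ∃ (i : I) (w : (fam i).Ω) (j' : ℕ),
          (fam i).flow.SatisfiesRG (fam i).K ∧ H033 (fam i).flow (fam i).K ∧ 1 ≤ j' ∧ j' ≤ (fam i).K ∧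
          (fam i).K - j' = K - j ∧ (fam i).K ≤ K + K₁ ∧
          (∀ n, 0 ≤ (fam i).gammaVol n w) ∧ (fam i).gammaVol (fam i).K w ≤ S.vol ∧
          (∀ n, n < (fam i).K → n < jlogOf Cl (fam i).K → (fam i).gammaVol n w = 0) ∧
          (∀ n, n < (fam i).K → jlogOf Cl (fam i).K ≤ n → (fam i).gammaVol n w ≤ S.vol * Gv ^ ((fam i).K - n)) ∧
          |∑ X ∈ (L.fac K t τ).filter (fun X => ¬ dressed X) with R.u3.C.scale X = j,
              (R.u3.EA (g K) (uA K v) X - R.u3.EA (g K) L.oneA X)| ≤ |(fam i).eTerm j' (fam i).K w|) ∧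
        -- (ii-v-B) run B's vacuum slices ↔ printed E-terms
        (∀ K t, |t| ≤ S.l₀ → ∀ τ ∈ S.T K \ S.Bad K t, ∀ v ∈ Rd.dom, ∀ j ≤ K, ∃ (i : I) (w : (fam i).Ω) (j' : ℕ),
          (fam i).flow.SatisfiesRG (fam i).K ∧ H033 (fam i).flow (fam i).K ∧ 1 ≤ j' ∧ j' ≤ (fam i).K ∧
          (fam i).K - j' = K - j ∧ (fam i).K ≤ K + K₁ ∧
          (∀ n, 0 ≤ (fam i).gammaVol n w) ∧ (fam i).gammaVol (fam i).K w ≤ S.vol ∧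
          (∀ n, n < (fam i).K → n < jlogOf Cl (fam i).K → (fam i).gammaVol n w = 0) ∧
          (∀ n, n < (fam i).K → jlogOf Cl (fam i).K ≤ n → (fam i).gammaVol n w ≤ S.vol * Gv ^ ((fam i).K - n)) ∧
          |∑ X ∈ (L.fac K t τ).filter (fun X => ¬ dressed X) with R.u3.C.scale X = j,
              (EB (fun i => g (K + 1) (i + 1)) (uB K v) X - EB (fun i => g (K + 1) (i + 1)) L.oneB X)|
            ≤ |(fam i).eTerm j' (fam i).K w|) ∧
        -- (ii-d) the dressed sub-ledger ↔ N14's bookings on `R.ne1.𝒯`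
        (∀ K t, |t| ≤ S.l₀ → ∀ τ ∈ S.T K \ S.Bad K t, ∀ v ∈ Rd.dom,
          ∃ (pA : R.ne1.P) (βA : R.u3.C.Dom → (R.ne1.𝒯.B pA K).Birth) (Q : Finset (R.ne1.𝒯.B pA K).Cube) (pB : R.ne1.P)
            (KB : ℕ) (βB : R.u3.C.Dom → (R.ne1.𝒯.B pB KB).Birth),
          (∀ X ∈ (L.fac K t τ).filter (fun X => dressed X), (R.ne1.𝒯.B pA K).birthScale (βA X) = R.u3.C.scale X) ∧
          (∀ j, Set.InjOn βA ↑(((L.fac K t τ).filter (fun X => dressed X)).filter fun X => R.u3.C.scale X = j)) ∧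
          (∀ c ∈ Q, (R.ne1.𝒯.B pA K).cubeScale c = K) ∧ ((Q.card : ℝ) ≤ S.vol) ∧
          (∀ X ∈ (L.fac K t τ).filter (fun X => dressed X), ∃ c ∈ Q, βA X ∈ (R.ne1.𝒯.B pA K).feltAt c) ∧
          (∀ X ∈ (L.fac K t τ).filter (fun X => dressed X), KB - (R.ne1.𝒯.B pB KB).birthScale (βB X) = K - R.u3.C.scale X) ∧
          (∀ X ∈ (L.fac K t τ).filter (fun X => dressed X),
            |R.u3.EA (g K) (uA K v) X - R.u3.EA (g K) L.oneA X| ≤ (R.ne1.𝒯.B pA K).size (βA X) K) ∧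
          (∀ X ∈ (L.fac K t τ).filter (fun X => dressed X),
            |EB (fun i => g (K + 1) (i + 1)) (uB K v) X - EB (fun i => g (K + 1) (i + 1)) L.oneB X|
              ≤ (R.ne1.𝒯.B pB KB).size (βB X) KB)) ∧
        -- (v′-16) N16 BY NAME: THE END's regime letters of `R.ne3`, N07's interface, the selection, NE7 route-#1's side letters, the
        -- reading map, the action-reading identification, the offset, the gauge-domination convention
        R.ne3.g = gradConst 4 c' ∧ 2 ≤ R.ne3.L ∧ 1 ≤ R.ne3.Nper ∧ 0 ≤ R.ne3.b ∧ 0 ≤ c' ∧ R.ne3.b ≤ t ∧ c' ≤ t ∧ 0 ≤ R.ne3.C ∧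
        (2 : ℝ) ^ 91 * (R.ne3.L : ℝ) ^ 17 * t ≤ 1 ∧ (2 : ℝ) ^ 76 * (R.ne3.L : ℝ) ^ 12 * t ≤ R.ne3.ε ∧
        16 * B7Prop2Explicit.C0 4 * R.ne3.ε ≤ 3 ∧ 1024 * (4 + 1) * (4 + 4) * (R.ne3.L : ℝ) ^ 2 * R.ne3.ε ≤ 1 ∧
        ε₁ ≤ 1 / 4 ∧ ε₁ ≤ R.ne3.b ∧ 4 * ε₁ ≤ c' ∧ R.ne3.dom ⊆ sfClass 4 R.ne3.L R.ne3.Nper ε₁ 0 ∧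
        LeafH3sup 4 R.ne3.L R.ne3.Nper R.ne3.ε R.ne3.b c' R.ne3.dom ∧
        (∀ V ∈ R.ne3.dom, ∀ k : ℕ, IsMinimiser 4 (sfClass 4 R.ne3.L R.ne3.Nper R.ne3.ε) R.ne3.L R.ne3.Nper k V (sel k V)) ∧
        (∀ V ∈ R.ne3.dom, ∀ k : ℕ, RegularSup 4 R.ne3.L R.ne3.Nper R.ne3.b c' k (sel k V)) ∧
        0 < θ ∧ θ ^ 6 = ((R.ne3.L : ℝ))⁻¹ ∧ 0 < R.ne3.Λ₂' ∧ 0 < γ₃ ∧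
        R.ne3.C * (wallConst 4 R.ne3.L * (R.ne3.Nper : ℝ) ^ 2 *
          (Real.sqrt (gradConst 4 c') * dualC2 4 R.ne3.L + 2 * R.ne3.b ^ 2 * dualC1 4 R.ne3.L)) ≤ γ₃ ^ 3 ∧
        0 < l₁ ∧ R.ne3.Λ₁ ≤ l₁ ^ 3 ∧ γ₃ * θ ^ 2 ≤ l₁ * R.ne3.Nper ∧ ((R.ne3.L : ℝ))⁻¹ ≤ θ₃ ∧ θ ^ 8 ≤ θ₃ ∧ θ₃ < 1 ∧
        (∀ v ∈ Rd.dom, rd v ∈ R.ne3.dom) ∧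
        (∀ k, ∀ v ∈ Rd.dom, Rd.act k v = minAct 4 (sfClass 4 R.ne3.L R.ne3.Nper R.ne3.ε) R.ne3.L R.ne3.Nper k (rd v)) ∧
        (R.ne3.Nper : ℝ) ^ 4 ≤ Rd.vol ∧ 1 ≤ k₀ ∧
        (∀ K : ℕ, ∀ v ∈ Rd.dom, ∀ (u : B7Prop1Explicit.Site 4 → (Matrix (Fin N) (Fin N) ℂ)ˣ)
          (Z : B7Prop1Explicit.Site 4 → Fin 4 → Matrix (Fin N) (Fin N) ℂ) (M : ℝ),
          IsUnitarySite u → IsPeriodicSite u ((R.ne3.Nper * R.ne3.L ^ (k₀ + K) : ℕ) : ℤ) → T4AveragingDeficitWall.IsSkewDir Z →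
          IsPeriodicDir Z ((R.ne3.Nper * R.ne3.L ^ (k₀ + K) : ℕ) : ℤ) →
          B7Prop1Explicit.gaugeAct u (sel (k₀ + K) (rd v)) =
            T4AveragingDeficitWall.vary (B7Prop2Explicit.rescale R.ne3.L (B7Prop1Explicit.bavg R.ne3.L (sel (k₀ + K + 1) (rd v)))) Z 1 →
          (∀ (x : B7Prop1Explicit.Site 4) (κ : Fin 4), ‖Z x κ‖ ≤ M) → R.u3.C.gauge (uA K v) (R.u3.C.transport (uB K v)) ≤ M) ∧
        -- letter signs
        0 ≤ R.u3.θ ∧ 0 ≤ R.u3.C₅ ∧ 0 ≤ R.u3.ω ∧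
        -- (v′-17) N17 BY NAME: the (0.20)-run identification, the infrared pin, (D4), the β-window, the smallness window, rates
        (∀ K, RGEqH K D.βfun (g K)) ∧ (∀ K, g K K = gIR) ∧ ReadOutAt D R.u3 ∧ 0 < bβ ∧
        EventualLowerH bβ R.u3.γ k₀β D.βfun ∧
        R.u3.cr * R.u3.C₉ * R.u3.ω * (((k₀β : ℝ) + 1) * R.u3.γ ^ 3 + 2 * R.u3.γ / bβ) ≤ (1 - R.u3.ρ) / 2 ∧
        0 < R.u3.ρ ∧ R.u3.ρ < 1 ∧ 0 < R.u3.γ ∧ R.u3.ρ ≤ θc ∧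
        -- the box
        (∀ K i, i ≤ K → 0 < g K i ∧ g K i ≤ R.u3.γ) ∧
        -- the bracket (T) IN THE TUBE CURRENCY (`N19LipBracketTube.lipBracket_at_rateCarriers_of_pairDisc`'s inputs): the (1.18) real
        -- bound; the pair-disc shape at the printed tube radius κ₁·α(C₁, q₁, s_j) ((2.27)(ii)(iv) through the (1.13)∕(2.39) tube — SHAPE,
        -- NODE O); signs; the window's smallness; the UPPER running of the tables ((2.6) ∕ (0.31) upper half, β-side conditional, DISPLAYED)
        DecayBound R.u3.EA R.u3.W E₀T R.u3.κ ∧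
        (∀ s ∈ R.u3.W, ∀ (X : R.u3.C.Dom) (U U' : R.u3.C.BgA),
          R.u3.C.gauge U U' < κ₁T * B14.alphaJ C₁T q₁ (s (R.u3.C.scale X)) →
          ∃ f : ℂ → ℂ, DifferentiableOn ℂ f (Metric.ball (0 : ℂ) (κ₁T * B14.alphaJ C₁T q₁ (s (R.u3.C.scale X)))) ∧
            f 0 = (R.u3.EA s U X : ℂ) ∧ f (R.u3.C.gauge U U' : ℂ) = (R.u3.EA s U' X : ℂ) ∧
            ∀ z ∈ Metric.ball (0 : ℂ) (κ₁T * B14.alphaJ C₁T q₁ (s (R.u3.C.scale X))),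
              ‖f z‖ ≤ E₀T * Real.exp (-(R.u3.κ * R.u3.C.d X))) ∧
        0 ≤ E₀T ∧ 0 < κ₁T ∧ 0 < C₁T ∧ (∀ s ∈ R.u3.W, ∀ j, 0 < s j ∧ s j ^ 2 ≤ Real.exp (-1)) ∧
        (∀ K j, j ≤ K → 1 / g K j ^ 2 ≤ 1 / gIR ^ 2 + β'T * ((K : ℝ) - j)) ∧ 0 ≤ β'T ∧
        -- window memberships, selector compatibility
        (∀ K, g K ∈ R.u3.W) ∧ (∀ K, (fun i => g (K + 1) (i + 1)) ∈ R.u3.W) ∧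
        (∀ s ∈ R.u3.W, 0 < bsel s ∧ bsel s ≤ R.u3.γ)) :
    ∀ (F : T4Continuum.T4Family) (D : YMDAG.UVSplit.Datum F N) (g₀ : ℕ → ℝ) (os : List (T4Continuum.ULoop F))
      (S : SpineCarriers) (R : RateCarriers N), SRec F D g₀ os S → RRec F D g₀ os R → RatesAt D R → letI := S.dec
      ∃ δ : ℕ → ℝ, NE7.Core S.l₀ S.vol S.T S.Bad (fun K t τ => S.A K t τ - S.shA K t τ)
        (fun K t τ => S.B K t τ - S.shB K t τ) δ ∧ Summable δ := by
  intro F D g₀ os S R hS hR hrates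
  letI := S.dec
  -- destructure the link reading IN STAGES (one flat 113-component `obtain` is quadratic in the pattern count: ≈ 14 min on the farm)
  obtain ⟨_, F', ι', X', _, L, Rd, bsel, EB, θc, θ₃, g, uA, uB, hrest⟩ := hlink F D g₀ os S R hS hR
  obtain ⟨Pf, d₀, L₀, Koff, cells, H033, I, fam, Lb, β, κ₁, Gv, Cl, K₁, Λ₀, N₀, dressed, _, hrest⟩ := hrest
  obtain ⟨c', t, ε₁, θ, γ₃, l₁, sel, rd, k₀, gIR, bβ, k₀β, E₀T, κ₁T, C₁T, β'T, q₁, hrest⟩ := hrest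
  obtain ⟨hEB, hL, hvol, homult, hCw, hΛg, hθΛ, hPd, hPL, hPK, hcard, hκ₀, hdom, hinj, hlen, hrest⟩ := hrest
  obtain ⟨h11, hβ1, hβ0, hLb, hGv, hCl, hcount, hN₀, hΛ₀, hle, hidA, hidB, hidD, hrest⟩ := hrest
  -- (v′-16)
  obtain ⟨hg3, hL2, hNper, hb, hc', hbt, hct, hC3, hsmall3, hεt, hε1, hε2, hε₁, hε₁b, hε₁c, hdom3, hH3, hsel, hreg, hrest⟩ := hrest
  obtain ⟨hθ0, hθ6, hΛ₂', hγ₃, hγ3, hl₁, hΛl₁, hfit, hθ₃L, hθ₃θ, hθ₃1, hrd, hact, hvol3, hk₀, hdomc, hrest⟩ := hrest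
  -- signs, (v′-17), the box
  obtain ⟨hθ, hC₅, hω, hrun, hpin, hD4, hbβ, hlo, hsmallβ, hρ0, hρ1, hγu, hρθc, hbox, hrest⟩ := hrest
  -- (T) in the tube currency, windows, selector
  obtain ⟨hdecT, hdiscT, hE₀T, hκ₁T, hC₁T, hWsm, hup, hβ'T, hgA, hgB, hbsel⟩ := hrest
  -- the bracket (T) PRODUCED from the tube inputs (`N19LipBracketTube` §4); the infrared coupling is positive by the box and the pin
  have hgIR : 0 < gIR := by
    have h := (hbox 0 0 le_rfl).1
    rwa [hpin 0] at h
  obtain ⟨CU, Pg, hU, hG, hPg⟩ :=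
    lipBracket_at_rateCarriers_of_pairDisc R hdecT hdiscT hE₀T hκ₁T hC₁T hWsm hgA hup hgIR hβ'T
  haveI : Nonempty (Fin N) := ⟨⟨0, Nat.pos_of_ne_zero (NeZero.ne N)⟩⟩
  -- N14 · N18 · N22 from `RatesAt D R` by name (as in gen 3)
  have h14 : DressedStabilityStrict R.ne1.𝒯 R.ne1.Λ := dressedStabilityStrict_of_n14At hrates.1
  have h18 : NE5 R.u3.EA EB R.u3.W R.u3.κ R.u3.θ R.u3.C₅ := by
    rw [hEB]; exact ne5_of_n18At R.u3 hrates.2.2.2.2.1 bsel hbsel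
  have h22 : NE9 R.u3.EA R.u3.W R.u3.κ R.u3.Λ ∧ T4OutputRate.FadingMemory R.u3.C₉ R.u3.ω R.u3.Λ := hrates.2.2.2.2.2
  -- N16 from `RatesAt D R` by name: the covariant root at the bundle, read with `R.ne3.g = gradConst 4 c′`
  have h16 : NE3EnergyWeightedCovShape.NE3EnergyRateWCov 4 (sfClass 4 R.ne3.L R.ne3.Nper R.ne3.ε) R.ne3.L R.ne3.Nper R.ne3.b
      (gradConst 4 c') R.ne3.C R.ne3.Λ₁ R.ne3.Λ₂' R.ne3.dom := by
    rw [← hg3]; exact hrates.2.2.1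
  obtain ⟨C₃, loc, hC₃, h16', hgd⟩ :=
    ne3Liaison_of_covRoot (n := Fin N) hL2 hNper hb hc' hbt hct hC3 hsmall3 hεt hε1 hε2 hε₁ hε₁b hε₁c hdom3 h16 hH3 sel hsel hreg
      hθ0 hθ6 hΛ₂' hγ₃ hγ3 hl₁ hΛl₁ hfit hθ₃L hθ₃θ hθ₃1 Rd rd hrd hact hvol3 uA uB hk₀ hdomc
  -- N17 from `RatesAt D R` by name: node U2's output on the tables, companions from (D4) · N18 · N22, worsened to the record's rate `θc`
  have hc17 : 0 ≤ R.u3.cr * R.u3.C₅ * R.u3.θ :=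
    (N19InEdgesAtRecord.histCompanions_of_readOutAt D hD4 hrates.2.2.2.2.1 hrates.2.2.2.2.2).2.2.1
  have hCd : 0 ≤ 2 * (R.u3.cr * R.u3.C₅ * R.u3.θ) / (1 - R.u3.ρ) := div_nonneg (mul_nonneg zero_le_two hc17) (by linarith)
  have hinj17 : InjectedRate (2 * (R.u3.cr * R.u3.C₅ * R.u3.θ) / (1 - R.u3.ρ)) 0 θc
      (fun K j => T4CouplingMatching.disc (g K) (g (K + 1)) j) :=
    (injectedRate_of_n17At_readOutAt D hrates.2.2.2.1 hD4 hrates.2.2.2.2.1 hrates.2.2.2.2.2 hγu hbβ hρ0 hρ1 hrun hbox hpin hlo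
      hsmallβ).mono_rate hCd hρ0.le hρθc
  have hθc : 0 ≤ θc := hρ0.le.trans hρθc
  -- knit v6 on the re-localised readings family (the ledger predicate transfers: `ledgerAtSync_withLoc`)
  exact core_summable_of_ledgerAtSync_multByName (R := (⟨Rd.dom, Rd.act, loc, Rd.vol, Rd.vol_nonneg⟩ : Readings ι' Unit))
    (fun Sz E₀ m a Cw Λg hSz hE₀ ha0 ha1 hSle hm hom hΛ1 hθΛ' =>
      ledgerAtSync_withLoc (hL Sz E₀ m a Cw Λg hSz hE₀ ha0 ha1 hSle hm hom hΛ1 hθΛ') loc)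
    hvol homult hCw hΛg hθΛ Pf hPd hPL hPK hcard hκ₀ cells hdom hinj hlen H033 fam h11 hβ1 hβ0 hLb hGv hCl K₁ ⟨h14, hcount⟩ hN₀ hΛ₀
    hle dressed hidA hidB hidD h16' hC₃ hgd h18 hθ hC₅ h22 hω hinj17 hCd hθc hbox hU hG hPg hgA hgB

end Edge

end Summit.QuantumFields.YangMills.BalabanUVNodes.N19RateEdgeTube

end
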